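import Summits.Ventures.CertifiedManyBodySolver.Observables.KKTBlindness
import HarnessLib

/-!
# The charge-MIXED (Nambu) KKT block is never positive semidefinite on the invariant slice once the source is on
# (hubbard-cq census (38), class precision K1m/KZm — matrix level, U = 0 CAR evaluation on the face)

HONEST FRAMING: first certified bounds; not a superconductivity verdict. Certificate-GRAMMAR bookkeeping about what a
sourced KKT relaxation can see; nothing here is a number of the Hubbard model, an order parameter or a phase word.

Cell hubbard-cq, companion of `KKTBlindness.lean` (critic-1's kit, landed by p6): that file shows that a
`U(1)`-invariant pseudo-state passes every sourced KKT row built from CHARGE-HOMOGENEOUS generators except through the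
torque entries (census (38), confirmed by pilot-1's job K at K5 class). hubbard-cq-critic-2 g3 (STATUS
2026-08-27T00:32Z, structural finding from the obsb source), lens negation-1 g3 (00:41Z) and critic-1 g3 (INBOX 01:07Z,
«OK — FILE» with the sharpenings adopted below) observed that the `S_z`-homogeneous but charge-MIXED odd block over
`{a_{k↑}} ∪ {a†_{−k↓}}` — legitimate for the sourced grand-canonical problem `K = A(h)` — is NOT blind. The KKT object is the
sesquilinear form `C ↦ ω(O_Cᴴ[A(h), O_C])`; positive semidefiniteness is asked of the HERMITISED matrix `(M + Mᴴ)/2`,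
and every matrix below stands for that Hermitised block. On an invariant `ω` (U(1)-invariant pseudo-state):
* the OFF-DIAGONAL (Hermitised) entry is EXACT AT EVERY `U`: the interaction contributes a charge-`±2` expectation, which
  vanishes (`KKTBlindness.expect_eq_zero_of_invariant`); by the CAR it equals `c = h·g_k·(1 + n − n′)/2` with `n = n_{k↑}`,
  `n′ = n_{−k↓}` (critic-1 01:07Z; `g_k` = the momentum weight of the tree's `Δ_d = pairField dWaveFormFactor` in the
  source `A(h) = K − h(Δ_d + Δ_dᴴ)` = `dWaveSourceTorusTT'`; critic-2 writes the same entry `√2·h·ĝ(k)` in the obsB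
  convention `a₀ = h₀ − g(D₀ + D₀†)`, `D₀ = √2·P₀^d`, `h_tree = √2·g`);
* the DIAGONAL is a **U = 0 CAR evaluation**: removal / addition costs `−ξ_k·n` and `ξ_k·(1 − n′)`. At `U > 0` the
  diagonal acquires incoherent weight `α_k, β_k ≥ 0` and the block passes iff `c² ≤ α_kβ_k` — THAT inequality is the KZm
  question at `U = 8` (pilot-2 kit j263756); so everything here is a `U = 0` statement about the diagonal, taken as a
  HYPOTHESIS on the entries (no CAR algebra is typed in this file).
THIS FILE (lead ACKS 42/54/60, seat hubbard-cq-p2 g3): `not_posSemidef_of_det_neg` (Mathlib `PosSemidef.det_nonneg`);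
the TWO-DENSITY block `nambuBlock_not_posSemidef` (`!![−ξn, c; c, ξ(1 − n′)]` with `0 ≤ n`, `n′ ≤ 1`, `c ≠ 0` is not PSD:
`det = −ξ²n(1 − n′) − c² < 0` — no symmetrisation `n = n′` assumed), the symmetric-slice / `Δ/2` / `√2·h·g` spellings, the
ENTRY and PRINCIPAL-MINOR forms for a block inside a larger KKT matrix, and critic-1's JOINT `±k` statement
`not_posSemidef_nambuBlocks_pm`: with the exact off-diagonals `c₊ = hg(1 + n − n′)/2` (pair `(a_{k↑}, a†_{−k↓})`) and
`c₋ = hg(1 + n′ − n)/2` (pair `(a_{−k↓}, a†_{k↑})`, `g_{−k} = g_k`), the two blocks cannot both be PSD when `h·g ≠ 0`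
(each forces its `c` to vanish, and `c₊ = c₋ = 0` gives `2 = 0`) — «no U(1)-invariant point passes the two mixed blocks
at ±k whenever h·g_k ≠ 0», census (38) K1m/KZm clause at `U = 0`, kernel-checked. Zero compute; no definition; no named
fact; no `sorry`. References: critic-2 TOOLKIT/TEST A, critic-1 OBSTRUCTIONS v1.6 (cell files); R. A. Horn,
C. R. Johnson, Matrix Analysis (2013) §7.1 (principal minors of PSD matrices) [HornJohnson2013].
-/

noncomputable section

namespace Summit.Ventures.CertifiedManyBodySolver.Observables

open Matrix
open scoped ComplexOrder

namespace KKTBlindness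

/-! ### §1 A negative determinant excludes positive semidefiniteness -/

/-- A complex matrix with NEGATIVE determinant is not positive semidefinite (PSD ⇒ `det ≥ 0`,
`Matrix.PosSemidef.det_nonneg`). [cite: HornJohnson2013, §7.1] -/
theorem not_posSemidef_of_det_neg {m : Type*} [Fintype m] [DecidableEq m] {A : Matrix m m ℂ} (h : A.det < 0) :
    ¬ A.PosSemidef :=
  fun hA => lt_irrefl (0 : ℂ) (lt_of_le_of_lt hA.det_nonneg h)

/-- Real twin: a real matrix with negative determinant is not positive semidefinite. [cite: HornJohnson2013, §7.1] -/
theorem not_posSemidef_of_det_neg_real {m : Type*} [Fintype m] [DecidableEq m] {A : Matrix m m ℝ}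
    (h : A.det < 0) : ¬ A.PosSemidef :=
  fun hA => lt_irrefl (0 : ℝ) (lt_of_le_of_lt hA.det_nonneg h)

/-- A matrix with a principal submatrix of negative determinant is not positive semidefinite (PSD passes to principal
submatrices, `Matrix.PosSemidef.submatrix`). [cite: HornJohnson2013, §7.1] -/
theorem not_posSemidef_of_submatrix_det_neg {m k : Type*} [Fintype m] [Fintype k] [DecidableEq k]
    {A : Matrix m m ℂ} (e : k → m) (h : (A.submatrix e e).det < 0) : ¬ A.PosSemidef :=
  fun hA => not_posSemidef_of_det_neg h (hA.submatrix e)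

/-! ### §2 The Hermitised two-density Nambu block `[[−ξn, c], [c, ξ(1 − n′)]]` -/

/-- Determinant of the Hermitised mixed block with real entries (complex spelling). [folklore] -/
theorem nambuBlock_det (ξ n n' c : ℝ) :
    (!![((-ξ * n : ℝ) : ℂ), ((c : ℝ) : ℂ); ((c : ℝ) : ℂ), ((ξ * (1 - n') : ℝ) : ℂ)]).det =
      (((-ξ * n) * (ξ * (1 - n')) - c * c : ℝ) : ℂ) := by
  rw [Matrix.det_fin_two_of]
  push_cast
  ring

/-- The determinant is negative: `−ξ²·n(1 − n′) − c² < 0` for `0 ≤ n`, `n′ ≤ 1`, `c ≠ 0`. [folklore] -/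
theorem nambuBlock_det_real_neg (ξ n n' c : ℝ) (hn : 0 ≤ n) (hn' : n' ≤ 1) (hc : c ≠ 0) :
    (-ξ * n) * (ξ * (1 - n')) - c * c < 0 := by
  have h1 : 0 ≤ ξ * ξ * (n * (1 - n')) := mul_nonneg (mul_self_nonneg ξ) (mul_nonneg hn (sub_nonneg.2 hn'))
  have h2 : 0 < c * c := mul_self_pos.2 hc
  nlinarith

/-- **The Hermitised mixed Nambu block is NOT positive semidefinite** (TWO-DENSITY form, no symmetrisation): hole row
`−ξ·n` (`n = n_{k↑} ≥ 0`), particle row `ξ·(1 − n′)` (`n′ = n_{−k↓} ≤ 1`), off-diagonal `c ≠ 0` ⇒ `¬ PSD`. With the exact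
invariant-slice value `c = h·g_k(1 + n − n′)/2` and the `U = 0` CAR diagonal, this is the per-momentum K1m/KZm obstruction
of census (38). [cite: HornJohnson2013, §7.1] -/
theorem nambuBlock_not_posSemidef (ξ n n' c : ℝ) (hn : 0 ≤ n) (hn' : n' ≤ 1) (hc : c ≠ 0) :
    ¬ (!![((-ξ * n : ℝ) : ℂ), ((c : ℝ) : ℂ); ((c : ℝ) : ℂ), ((ξ * (1 - n') : ℝ) : ℂ)]).PosSemidef := by
  apply not_posSemidef_of_det_neg
  rw [nambuBlock_det, ← Complex.ofReal_zero]
  exact Complex.real_lt_real.2 (nambuBlock_det_real_neg ξ n n' c hn hn' hc)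

/-- Real-matrix twin of `nambuBlock_not_posSemidef`. [cite: HornJohnson2013, §7.1] -/
theorem nambuBlock_not_posSemidef_real (ξ n n' c : ℝ) (hn : 0 ≤ n) (hn' : n' ≤ 1) (hc : c ≠ 0) :
    ¬ (!![-ξ * n, c; c, ξ * (1 - n')] : Matrix (Fin 2) (Fin 2) ℝ).PosSemidef := by
  apply not_posSemidef_of_det_neg_real
  rw [Matrix.det_fin_two_of]
  have := nambuBlock_det_real_neg ξ n n' c hn hn' hc
  linarith

/-- **Contrapositive**: a PSD Hermitised mixed block with `0 ≤ n`, `n′ ≤ 1` has ZERO off-diagonal entry.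
[cite: HornJohnson2013, §7.1] -/
theorem offDiag_eq_zero_of_nambuBlock_posSemidef {ξ n n' c : ℝ} (hn : 0 ≤ n) (hn' : n' ≤ 1)
    (hpsd : (!![((-ξ * n : ℝ) : ℂ), ((c : ℝ) : ℂ); ((c : ℝ) : ℂ), ((ξ * (1 - n') : ℝ) : ℂ)]).PosSemidef) : c = 0 := by
  by_contra hc
  exact nambuBlock_not_posSemidef ξ n n' c hn hn' hc hpsd

/-- SYMMETRIC-SLICE spelling (`n_{k↑} = n_{−k↓} = n ∈ [0,1]`, supplied by a program's inversion/spin rows) with a generic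
source entry written `Δ/2` (`Δ ≠ 0`): `¬ PSD [[−ξn, Δ/2], [Δ/2, ξ(1 − n)]]`. [cite: HornJohnson2013, §7.1] -/
theorem nambuBlockSym_not_posSemidef (ξ n Δ : ℝ) (hn0 : 0 ≤ n) (hn1 : n ≤ 1) (hΔ : Δ ≠ 0) :
    ¬ (!![((-ξ * n : ℝ) : ℂ), ((Δ / 2 : ℝ) : ℂ); ((Δ / 2 : ℝ) : ℂ), ((ξ * (1 - n) : ℝ) : ℂ)]).PosSemidef :=
  nambuBlock_not_posSemidef ξ n n (Δ / 2) hn0 hn1 (div_ne_zero hΔ two_ne_zero)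

/-- **critic-2's spelling** of the same entry, `√2·h·g` (obsB source convention `a₀ = h₀ − g(D₀ + D₀†)`, `D₀ = √2·P₀^d`;
`det = −ξ²n(1 − n′) − 2h²g²`): not PSD whenever `h·g ≠ 0`. [cite: HornJohnson2013, §7.1] -/
theorem nambuBlockHG_not_posSemidef (ξ n n' h g : ℝ) (hn : 0 ≤ n) (hn' : n' ≤ 1) (hhg : h * g ≠ 0) :
    ¬ (!![((-ξ * n : ℝ) : ℂ), ((Real.sqrt 2 * h * g : ℝ) : ℂ);
        ((Real.sqrt 2 * h * g : ℝ) : ℂ), ((ξ * (1 - n') : ℝ) : ℂ)]).PosSemidef :=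
  nambuBlock_not_posSemidef ξ n n' _ hn hn' (by
    rw [mul_assoc]
    exact mul_ne_zero (Real.sqrt_ne_zero'.2 (by norm_num)) hhg)

/-! ### §3 Entry and principal-minor forms (the shape a consumer meets after evaluating the ω-entries) -/

/-- **Entry form.** ANY complex `2 × 2` matrix with entries `Q₀₀ = −ξn`, `Q₁₁ = ξ(1 − n′)`, `Q₀₁ = Q₁₀ = c` (`0 ≤ n`,
`n′ ≤ 1`, `c ≠ 0`) is not PSD — the form in which `KKTBlindness.secondOrder_entry_of_invariant` (diagonal = unsourced
charge-diagonal entries, off-diagonal = `−h`× pair-transfer entries) plus the free-mode CAR algebra deliver an invariant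
pseudo-state's Hermitised mixed block. [cite: HornJohnson2013, §7.1] -/
theorem not_posSemidef_of_nambuEntries {Q : Matrix (Fin 2) (Fin 2) ℂ} {ξ n n' c : ℝ} (hn : 0 ≤ n) (hn' : n' ≤ 1)
    (hc : c ≠ 0) (h00 : Q 0 0 = ((-ξ * n : ℝ) : ℂ)) (h01 : Q 0 1 = ((c : ℝ) : ℂ)) (h10 : Q 1 0 = ((c : ℝ) : ℂ))
    (h11 : Q 1 1 = ((ξ * (1 - n') : ℝ) : ℂ)) : ¬ Q.PosSemidef := by
  have hQ : Q = !![((-ξ * n : ℝ) : ℂ), ((c : ℝ) : ℂ); ((c : ℝ) : ℂ), ((ξ * (1 - n') : ℝ) : ℂ)] := by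
    ext i j
    fin_cases i <;> fin_cases j <;> simp [h00, h01, h10, h11]
  rw [hQ]
  exact nambuBlock_not_posSemidef ξ n n' c hn hn' hc

/-- **Principal-minor form**: if a Hermitised KKT block matrix `A` of any size carries the Nambu pair at indices `i, j`
(`A i i = −ξn`, `A j j = ξ(1 − n′)`, `A i j = A j i = c`, `0 ≤ n`, `n′ ≤ 1`, `c ≠ 0`), then `A` is not PSD: the invariant
pseudo-state is infeasible for the whole block. [cite: HornJohnson2013, §7.1] -/
theorem not_posSemidef_of_nambuMinor {m : Type*} [Fintype m] {A : Matrix m m ℂ} (i j : m) {ξ n n' c : ℝ}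
    (hn : 0 ≤ n) (hn' : n' ≤ 1) (hc : c ≠ 0) (hii : A i i = ((-ξ * n : ℝ) : ℂ)) (hij : A i j = ((c : ℝ) : ℂ))
    (hji : A j i = ((c : ℝ) : ℂ)) (hjj : A j j = ((ξ * (1 - n') : ℝ) : ℂ)) : ¬ A.PosSemidef :=
  fun hA => not_posSemidef_of_nambuEntries (Q := A.submatrix ![i, j] ![i, j]) hn hn' hc
    (by simpa only [Matrix.submatrix_apply, Matrix.cons_val_zero] using hii)
    (by simpa only [Matrix.submatrix_apply, Matrix.cons_val_zero, Matrix.cons_val_one, Matrix.head_cons] using hij)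
    (by simpa only [Matrix.submatrix_apply, Matrix.cons_val_zero, Matrix.cons_val_one, Matrix.head_cons] using hji)
    (by simpa only [Matrix.submatrix_apply, Matrix.cons_val_one, Matrix.head_cons, Matrix.cons_val_fin_one] using hjj)
    (hA.submatrix ![i, j])

/-! ### §4 The two blocks at `±k` are jointly infeasible (critic-1's sharpening: no symmetrisation assumed) -/

/-- **No U(1)-invariant point passes the two mixed blocks at `±k` when `h·g_k ≠ 0`** (`U = 0` CAR diagonal as
hypothesis-shaped entries; exact off-diagonals). Block at `k` (pair `(a_{k↑}, a†_{−k↓})`): `[[−ξn, c₊], [c₊, ξ(1 − n′)]]`,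
`c₊ = hg(1 + n − n′)/2`; block at `−k` (pair `(a_{−k↓}, a†_{k↑})`, `g_{−k} = g_k`, dispersion `ξ′ = ξ_{−k}`):
`[[−ξ′n′, c₋], [c₋, ξ′(1 − n)]]`, `c₋ = hg(1 + n′ − n)/2`; densities `n = n_{k↑}`, `n′ = n_{−k↓}` in `[0,1]`. If both were PSD,
both off-diagonals would vanish (`offDiag_eq_zero_of_nambuBlock_posSemidef`), i.e. `1 + n − n′ = 0 = 1 + n′ − n`, so `2 = 0`.
[cite: HornJohnson2013, §7.1] -/
theorem not_posSemidef_nambuBlocks_pm (ξ ξ' n n' h g : ℝ) (hn0 : 0 ≤ n) (hn1 : n ≤ 1) (hn'0 : 0 ≤ n') (hn'1 : n' ≤ 1)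
    (hhg : h * g ≠ 0) :
    ¬ ((!![((-ξ * n : ℝ) : ℂ), ((h * g * (1 + n - n') / 2 : ℝ) : ℂ);
          ((h * g * (1 + n - n') / 2 : ℝ) : ℂ), ((ξ * (1 - n') : ℝ) : ℂ)]).PosSemidef ∧
       (!![((-ξ' * n' : ℝ) : ℂ), ((h * g * (1 + n' - n) / 2 : ℝ) : ℂ);
          ((h * g * (1 + n' - n) / 2 : ℝ) : ℂ), ((ξ' * (1 - n) : ℝ) : ℂ)]).PosSemidef) := by
  rintro ⟨hP, hM⟩
  have h1 : h * g * (1 + n - n') / 2 = 0 := offDiag_eq_zero_of_nambuBlock_posSemidef hn0 hn'1 hP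
  have h2 : h * g * (1 + n' - n) / 2 = 0 := offDiag_eq_zero_of_nambuBlock_posSemidef hn'0 hn1 hM
  have h3 : h * g * (1 + n - n') = 0 := by linarith
  have h4 : h * g * (1 + n' - n) = 0 := by linarith
  rcases mul_eq_zero.1 h3 with h5 | h5
  · exact hhg h5
  · rcases mul_eq_zero.1 h4 with h6 | h6
    · exact hhg h6
    · linarith

/-- Quantifier form of §2 on the symmetric slice: there is NO occupation `n ∈ [0,1]` for which the Hermitised mixed block
with a non-zero source entry is PSD. [cite: HornJohnson2013, §7.1] -/
theorem not_exists_occupation_nambuBlock_posSemidef (ξ c : ℝ) (hc : c ≠ 0) :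
    ¬ ∃ n : ℝ, 0 ≤ n ∧ n ≤ 1 ∧
      (!![((-ξ * n : ℝ) : ℂ), ((c : ℝ) : ℂ); ((c : ℝ) : ℂ), ((ξ * (1 - n) : ℝ) : ℂ)]).PosSemidef := by
  rintro ⟨n, hn0, hn1, hpsd⟩
  exact nambuBlock_not_posSemidef ξ n n c hn0 hn1 hc hpsd

end KKTBlindness

end Summit.Ventures.CertifiedManyBodySolver.Observables

end
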